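import Summits.Ventures.CertifiedArithmetic.LowPrec.MXDot
import Summits.Ventures.CertifiedArithmetic.LowPrec.AccumulateRange

/-!
# Block-scaled (MX) GEMM inner products: exact block dots, `binary32` accumulation in any order

HONEST FRAMING (venture CertifiedArithmetic / cell `pub-lowprec`): certified error envelopes and
provably optimal rounding/accumulation schemes for low-precision formats under stated cost models;
every table by two implementations; no hardware or vendor claims.

The cell's block-scaled inner-product model: two MX vectors of `B` blocks (`k = 32` elements of an
OCP MX element format with an `E8M0` scale per block); per block the scaled dot product
`sⱼ = X·Y·Σ PᵢQᵢ` is formed EXACTLY in `binary32` whenever the scale codes satisfy the exponent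
condition of `MXDot.lean` (`cX + cY ≥ 107 / 113 / 111` for `E2M1 / E3M2 / E2M3`) and
`|sⱼ| ≤ maxRat`; the `B` block results are then accumulated in `binary32` in ANY order (an
arbitrary `SumTree` whose leaves are the `sⱼ`). END-TO-END BOUND (`MXBlock.abs_mxdot_eval_sub_le`):

  `|ŝ - Σⱼ sⱼ| ≤ (B - 1)·u'·Σⱼ|sⱼ|`,  `u' = u₃₂/(1 + u₃₂)`, `u₃₂ = 2^-24`,

under the single data hypothesis `(1 + (B-1)u')·Σⱼ|sⱼ| ≤ maxRat₃₂` (which puts every node in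
range, `AccumulateRange.lean`) — the Jeannerod–Rump any-order constant applied to EXACT leaves; the
element products and the 32-term block sums contribute NO error. Instances for MXFP4 (`E2M1`)
and MXFP6 (`E3M2`, `E2M3`). Deliberately NOT here: blocks whose scales violate the exponent
condition (then the block dot is not a binary32 value in general, `E2M1_dot_not_exact_of_small_scales`),
FP8-element MX blocks (exactness of the 32-term block sum in binary32 fails for wide-range elements).
-/

namespace Literature.ComputerArithmetic.FloatingPoint

namespace MXBlock

open MiniFloat
open Literature.ComputerArithmetic.JeannerodRump2018
open Literature.ComputerArithmetic.JeannerodRump2018.SumTree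

variable {φ : Format}

/-- GENERIC MX INNER PRODUCT BOUND: if every leaf of the accumulation tree `T` is (the exact value
of) a block dot product that is a `binary32` value, and `(1 + (B-1)u')·Σ|leaves| ≤ maxRat₃₂`, then
`|ŝ - s| ≤ (B-1)·u'·Σ|leaves|` for the `binary32` evaluation of `T` in its own order. [folklore] -/
theorem abs_eval_Binary32_sub_exact_le (T : SumTree)
    (hT : ∀ x ∈ T.leaves, ∃ z : MiniFloat Format.Binary32, z.toRat = x)
    (hS : (1 + ((T.leaves.length : ℚ) - 1)
        * (Format.Binary32.unitRoundoff / (1 + Format.Binary32.unitRoundoff))) * absSum T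
      ≤ Format.Binary32.maxRat) :
    |SumTree.eval (flα Format.Binary32) T - SumTree.exact T|
      ≤ ((T.leaves.length : ℚ) - 1)
        * (Format.Binary32.unitRoundoff / (1 + Format.Binary32.unitRoundoff)) * absSum T :=
  abs_eval_sub_exact_le_sharp_of_absSum_le (by decide) T hT hS

/-- MXFP4 (`E2M1`, `k = 32`) GEMM inner product over `B` blocks: blocks `a j`, `b j` with scale
codes `cX + cY ≥ 107` and `|dot| ≤ maxRat₃₂`; accumulation tree `T` (any order) whose leaves are the
block dot products; `(1 + (B-1)u')Σⱼ|dotⱼ| ≤ maxRat₃₂`. Then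
`|ŝ - Σⱼ dotⱼ| ≤ (B-1)·u'·Σⱼ|dotⱼ|`. [folklore] -/
theorem E2M1_mxdot_eval_sub_le (a b : ℕ → MXBlock Format.E2M1 32) (T : SumTree)
    (hleaves : ∀ x ∈ T.leaves, ∃ j, x = dot (a j) (b j))
    (hc : ∀ j, 107 ≤ (a j).scale.code + (b j).scale.code)
    (hr : ∀ j, |dot (a j) (b j)| ≤ Format.Binary32.maxRat)
    (hS : (1 + ((T.leaves.length : ℚ) - 1)
        * (Format.Binary32.unitRoundoff / (1 + Format.Binary32.unitRoundoff))) * absSum T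
      ≤ Format.Binary32.maxRat) :
    |SumTree.eval (flα Format.Binary32) T - SumTree.exact T|
      ≤ ((T.leaves.length : ℚ) - 1)
        * (Format.Binary32.unitRoundoff / (1 + Format.Binary32.unitRoundoff)) * absSum T := by
  refine abs_eval_Binary32_sub_exact_le T (fun x hx => ?_) hS
  obtain ⟨j, rfl⟩ := hleaves x hx
  exact E2M1_dot_exact_in_Binary32 (a j) (b j) (hc j) (hr j)

/-- MXFP6 `E3M2` (`k = 32`) GEMM inner product over `B` blocks (`cX + cY ≥ 113`). [folklore] -/
theorem E3M2_mxdot_eval_sub_le (a b : ℕ → MXBlock Format.E3M2 32) (T : SumTree)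
    (hleaves : ∀ x ∈ T.leaves, ∃ j, x = dot (a j) (b j))
    (hc : ∀ j, 113 ≤ (a j).scale.code + (b j).scale.code)
    (hr : ∀ j, |dot (a j) (b j)| ≤ Format.Binary32.maxRat)
    (hS : (1 + ((T.leaves.length : ℚ) - 1)
        * (Format.Binary32.unitRoundoff / (1 + Format.Binary32.unitRoundoff))) * absSum T
      ≤ Format.Binary32.maxRat) :
    |SumTree.eval (flα Format.Binary32) T - SumTree.exact T|
      ≤ ((T.leaves.length : ℚ) - 1)
        * (Format.Binary32.unitRoundoff / (1 + Format.Binary32.unitRoundoff)) * absSum T := by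
  refine abs_eval_Binary32_sub_exact_le T (fun x hx => ?_) hS
  obtain ⟨j, rfl⟩ := hleaves x hx
  exact E3M2_dot_exact_in_Binary32 (a j) (b j) (hc j) (hr j)

/-- MXFP6 `E2M3` (`k = 32`) GEMM inner product over `B` blocks (`cX + cY ≥ 111`). [folklore] -/
theorem E2M3_mxdot_eval_sub_le (a b : ℕ → MXBlock Format.E2M3 32) (T : SumTree)
    (hleaves : ∀ x ∈ T.leaves, ∃ j, x = dot (a j) (b j))
    (hc : ∀ j, 111 ≤ (a j).scale.code + (b j).scale.code)
    (hr : ∀ j, |dot (a j) (b j)| ≤ Format.Binary32.maxRat)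
    (hS : (1 + ((T.leaves.length : ℚ) - 1)
        * (Format.Binary32.unitRoundoff / (1 + Format.Binary32.unitRoundoff))) * absSum T
      ≤ Format.Binary32.maxRat) :
    |SumTree.eval (flα Format.Binary32) T - SumTree.exact T|
      ≤ ((T.leaves.length : ℚ) - 1)
        * (Format.Binary32.unitRoundoff / (1 + Format.Binary32.unitRoundoff)) * absSum T := by
  refine abs_eval_Binary32_sub_exact_le T (fun x hx => ?_) hS
  obtain ⟨j, rfl⟩ := hleaves x hx
  exact E2M3_dot_exact_in_Binary32 (a j) (b j) (hc j) (hr j)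

/-- The constant for `binary32`: `u' = 2^-24/(1 + 2^-24) = 1/16777217`. [folklore] -/
theorem Binary32_sharp_unit :
    Format.Binary32.unitRoundoff / (1 + Format.Binary32.unitRoundoff) = 1 / 16777217 := by
  rw [Format.unitRoundoff_values.2.2.2.2.2.2.2]; norm_num

end MXBlock

end Literature.ComputerArithmetic.FloatingPoint
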